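import Summits.ResolutionOfSingularities.ResolutionOfSingularities.Theorems.FrobeniusClosingSteerBetaNewtonTransport
import Summits.ResolutionOfSingularities.ResolutionOfSingularities.Theorems.FrobeniusClosingSteerBetaSquareVisibility
import Summits.ResolutionOfSingularities.ResolutionOfSingularities.Theorems.FrobeniusClosingSteerBetaPolygonAlphaStarTw
import Literature.AlgebraicGeometry.Resolution.CharPolyhedronMinimalIsMinimum
import HarnessLib

/-!
# Crux `Steer` (stmt-ResolutionOfSingularities-16345), chain W4.1, β-LEAF, K-β2♭ part (III), file G1: support for the GLUE
# `yLetterLawHat_of` — uniqueness of `v*`, the NEAR-POINT REGION of the `y`-chart origin on `𝐒(f)`, and `𝐒` of a twisted square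
# (def-free)

OURS (campaign `res-hironaka`, rung L ★L-G4, slot W4.1; statements about the route's own objects; they replace the
role of no printed item and are NOT statements of the manuscript under review [claim: Hironaka2017, status:
under-review]; AI review is weaker than expert review). Seat res-D-pv-003 (gen 7), K-β2♭ owner; GLUE (III) per
res-L0-w41-plan-1 RULING 276(a).

* `isVStarTw_unique` — the twisted star value is unique.
* `forall_minExponents_nearY` / `strictTransform_mem_pow_of_nearY` — along the `y`-chart letter, `f₁ ∈ 𝔪₁^d` iff every minimal
  exponent `a` of `f` with `a₂ + a₃ < d` satisfies `2(d − a₂ − a₃) ≤ 2a₀ + a₁` (the point `(A, B)` has `2A + B ≥ 2`).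
* `betaGe_zero_two_of_nearY` — in a near-point frame `BetaGe (0, 2)` holds; `vStar_pos_or_two_le` — hence `α* > 0 ∨ (α* = 0 ∧ β* ≥ 2)`;
  `betaGe_zero_two_of_vStar` — so every ATTAINING representative again satisfies `BetaGe (0, 2)`.
* `forall_minExponents_sum_sq`, `two_nsmul_add_mem_minExponents_sum_sq` — the minimal exponents of `Σ η_c² t^(2c + ε)` (unit `η_c`)
  are exactly the minimal elements of `{2c + ε}`.

[cite: CossartPiltant2019, Prop. 2.1 and 2.6] [cite: CossartJannsenSaito2020, Lemma 12.2] No Theses file is imported; nothing here is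
a route item or a registration.
-/

noncomputable section

-- `Summit.<S>.<S>.…` duplicates the summit name by design (single-problem summit).
set_option linter.dupNamespace false

namespace Summit.ResolutionOfSingularities.ResolutionOfSingularities.Theorems.SwitchingDichotomy.BetaNewton

open IsLocalRing
open Literature.AlgebraicGeometry.Resolution
open Literature.AlgebraicGeometry.Resolution.CossartPiltant (uPow uPow_mem_span_uPow uPow_mem_span_uPow_of_le minExponents
  mem_minExponents_of_isolated)
open Summit.ResolutionOfSingularities.ResolutionOfSingularities.Theorems.SwitchingDichotomy.BetaPolygon

variable {S S₁ : Type} [CommRing S] [CommRing S₁]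

/-! ## §1 Uniqueness of the twisted star value -/

/-- **The twisted star value `v* = (α*, β*)` is unique.** [folklore] -/
theorem isVStarTw_unique {u x y z w : S} {d : ℕ} {α β α' β' : ℚ} {f : S} (h : IsVStarTw u x y z w d α β f)
    (h' : IsVStarTw u x y z w d α' β' f) : α' = α ∧ β' = β := by
  obtain ⟨⟨z₁, w₁, f₁, r₁, a₁, b₁⟩, hα, hβ⟩ := h
  obtain ⟨⟨z₂, w₂, f₂, r₂, a₂, b₂⟩, hα', hβ'⟩ := h'
  have e : α' = α := le_antisymm (hα _ _ _ _ r₂ a₂) (hα' _ _ _ _ r₁ a₁)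
  subst e
  exact ⟨rfl, le_antisymm (hβ _ _ _ _ r₂ a₂ b₂) (hβ' _ _ _ _ r₁ a₁ b₁)⟩

/-! ## §2 The near-point region of the `y`-chart origin -/

/-- **`f₁ ∈ 𝔪₁^d` forces the near-point region**: along `φ x = φ y · x₁`, `φ z = φ y · z₁`, `φ w = φ y · w₁`, `g · (φ y)^d = φ f` with
`f ∈ 𝔪^d` and `g ∈ 𝔪₁^d`, every minimal exponent `a` of `f` has `a₂ + a₃ ≥ d` or `2(d − a₂ − a₃) ≤ 2a₀ + a₁`.
[cite: CossartPiltant2019, Prop. 2.6] -/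
theorem forall_minExponents_nearY [IsLocalRing S] [IsLocalRing S₁] (φ : S →+* S₁) {x y z w : S} {x₁ z₁ w₁ : S₁}
    (ht : IsRsopPart ![x, y, z, w]) (ht' : IsRsopPart ![x₁, φ y, z₁, w₁])
    (hspan : Ideal.span {x, y, z, w} = maximalIdeal S) (hspan₁ : Ideal.span {x₁, φ y, z₁, w₁} = maximalIdeal S₁)
    (hx : φ x = φ y * x₁) (hz : φ z = φ y * z₁) (hw : φ w = φ y * w₁) {d : ℕ} {f : S} {g : S₁}
    (hfd : f ∈ maximalIdeal S ^ d) (hg : g * φ y ^ d = φ f) (hgd : g ∈ maximalIdeal S₁ ^ d) :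
    ∀ a ∈ minExponents ![x, y, z, w] f, d ≤ a 2 + a 3 ∨ 2 * (d - a 2 - a 3) ≤ 2 * a 0 + a 1 := by
  intro a ha
  obtain ⟨-, h2⟩ := minExponents_strictTransform φ ht ht' hspan hspan₁ hx hz hw hfd hg
  obtain ⟨a', ha', hle⟩ := h2 a ha
  have hdeg' := (mem_pow_iff_forall_minExponents ht' hspan₁ d g).mp hgd a' ha'
  have hdeg := (mem_pow_iff_forall_minExponents ht hspan d f).mp hfd a ha
  rw [sum_four] at hdeg' hdeg
  obtain ⟨k0, k1, k2, k3⟩ := (le_transport_iff a a' d).mp hle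
  by_cases hzw : d ≤ a 2 + a 3
  · exact Or.inl hzw
  · right; omega

/-- **The near-point region forces `f₁ ∈ 𝔪₁^d`** (converse of `forall_minExponents_nearY`). [cite: CossartPiltant2019, Prop. 2.6] -/
theorem strictTransform_mem_pow_of_nearY [IsLocalRing S] [IsLocalRing S₁] (φ : S →+* S₁) {x y z w : S} {x₁ z₁ w₁ : S₁}
    (ht : IsRsopPart ![x, y, z, w]) (ht' : IsRsopPart ![x₁, φ y, z₁, w₁])
    (hspan : Ideal.span {x, y, z, w} = maximalIdeal S) (hspan₁ : Ideal.span {x₁, φ y, z₁, w₁} = maximalIdeal S₁)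
    (hx : φ x = φ y * x₁) (hz : φ z = φ y * z₁) (hw : φ w = φ y * w₁) {d : ℕ} {f : S} {g : S₁}
    (hfd : f ∈ maximalIdeal S ^ d) (hg : g * φ y ^ d = φ f)
    (hnear : ∀ a ∈ minExponents ![x, y, z, w] f, d ≤ a 2 + a 3 ∨ 2 * (d - a 2 - a 3) ≤ 2 * a 0 + a 1) :
    g ∈ maximalIdeal S₁ ^ d := by
  obtain ⟨h1, -⟩ := minExponents_strictTransform φ ht ht' hspan hspan₁ hx hz hw hfd hg
  refine (mem_pow_iff_forall_minExponents ht' hspan₁ d g).mpr fun a' ha' => ?_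
  obtain ⟨a, ha, rfl⟩ := h1 a' ha'
  have hdeg := (mem_pow_iff_forall_minExponents ht hspan d f).mp hfd a ha
  rw [sum_four] at hdeg
  rw [sum_transport]
  rcases hnear a ha with h | h <;> omega

/-- **In a near-point frame `BetaGe (0, 2)` holds**: every point has `A > 0` or `B ≥ 2`. [folklore] -/
theorem betaGe_zero_two_of_nearY [IsLocalRing S] {x y z w : S} (ht : IsRsopPart ![x, y, z, w]) {d : ℕ} {f : S}
    (hnear : ∀ a ∈ minExponents ![x, y, z, w] f, d ≤ a 2 + a 3 ∨ 2 * (d - a 2 - a 3) ≤ 2 * a 0 + a 1) :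
    BetaGe x y z w d 0 2 f := by
  refine (betaGe_iff_forall_minExponents ht le_rfl (by norm_num) f).mpr fun a ha => ?_
  rcases hnear a ha with h | h
  · exact Or.inl h
  · right
    rw [zero_mul, Nat.floor_zero, Nat.ceil_zero]
    by_cases h0 : 1 ≤ a 0
    · exact Or.inl h0
    · right
      refine ⟨Nat.zero_le _, ?_⟩
      have : ⌈(2 : ℚ) * ((d - a 2 - a 3 : ℕ) : ℚ)⌉₊ = 2 * (d - a 2 - a 3) := by
        rw [show (2 : ℚ) * ((d - a 2 - a 3 : ℕ) : ℚ) = ((2 * (d - a 2 - a 3) : ℕ) : ℚ) by push_cast; ring, Nat.ceil_natCast]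
      rw [this]; omega

/-- **`α* > 0`, or `α* = 0` and `β* ≥ 2`**, when the base representative satisfies `BetaGe (0, 2)`. [folklore] -/
theorem vStar_pos_or_two_le {u x y z w : S} {d : ℕ} {α β : ℚ} {f : S} (hV : IsVStarTw u x y z w d α β f)
    (hB : BetaGe x y z w d 0 2 f) : 0 < α ∨ (α = 0 ∧ 2 ≤ β) := by
  obtain ⟨-, hα, hβ⟩ := hV
  have h0 : 0 ≤ α := hα z w f 0 (isGaugeRepTw_refl u x y z w f) (alphaGe_zero x z w d f)
  rcases h0.lt_or_eq with h | h
  · exact Or.inl h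
  · right
    refine ⟨h.symm, hβ z w f 2 (isGaugeRepTw_refl u x y z w f) ?_ ?_⟩
    · rw [← h]; exact alphaGe_zero x z w d f
    · rw [← h]; exact hB

/-- **An attaining representative satisfies `BetaGe (0, 2)`** when `α* > 0 ∨ (α* = 0 ∧ β* ≥ 2)`. [folklore] -/
theorem betaGe_zero_two_of_vStar [IsLocalRing S] {x y z' w' : S} (ht : IsRsopPart ![x, y, z', w']) {d : ℕ} {α β : ℚ}
    {f' : S} (hpos : 0 < α ∨ (α = 0 ∧ 2 ≤ β)) (hA : AlphaGe x z' w' d α f') (hB : BetaGe x y z' w' d α β f') :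
    BetaGe x y z' w' d 0 2 f' := by
  refine (betaGe_iff_forall_minExponents ht le_rfl (by norm_num) f').mpr fun a ha => ?_
  rw [zero_mul, Nat.floor_zero, Nat.ceil_zero]
  by_cases hzw : d ≤ a 2 + a 3
  · exact Or.inl hzw
  right
  rcases hpos with hα | ⟨rfl, hβ⟩
  · rcases (alphaGe_iff_forall_minExponents ht hα.le f').mp hA a ha with h | h
    · exact absurd h hzw
    · left
      have hm : (0 : ℚ) < ((d - a 2 - a 3 : ℕ) : ℚ) := by exact_mod_cast (show 0 < d - a 2 - a 3 by omega)
      have : 0 < ⌈α * ((d - a 2 - a 3 : ℕ) : ℚ)⌉₊ := Nat.ceil_pos.mpr (mul_pos hα hm)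
      omega
  · rcases (betaGe_iff_forall_minExponents ht le_rfl (by linarith) f').mp hB a ha with h | h | ⟨-, h2⟩
    · exact absurd h hzw
    · left; simpa using h
    · right
      refine ⟨Nat.zero_le _, le_trans (Nat.ceil_mono ?_) h2⟩
      exact mul_le_mul_of_nonneg_right hβ (Nat.cast_nonneg _)

/-! ## §3 Minimal exponents of a twisted square `Σ η_c² t^(2c + ε)` -/

/-- The map `c ↦ 2c + ε` is injective. [folklore] -/
theorem two_nsmul_add_injective {n : ℕ} (ε : Fin n → ℕ) : Function.Injective (fun c : Fin n → ℕ => 2 • c + ε) := by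
  intro c c' h
  funext l
  have := congrFun h l
  simp only [Pi.add_apply, Pi.smul_apply, smul_eq_mul] at this
  omega

/-- **Every minimal exponent of `Σ_{c ∈ Q} η_c² t^(2c + ε)` is `2c + ε` for some `c ∈ Q`** (unit coefficients `η_c`).
[cite: CossartPiltant2019, Prop. 2.1] -/
theorem forall_minExponents_sum_sq [IsLocalRing S] {n : ℕ} {t : Fin n → S} (ht : IsRsopPart t) (Q : Finset (Fin n → ℕ))
    {η : (Fin n → ℕ) → S} (hη : ∀ c ∈ Q, η c ∉ Ideal.span (Set.range t)) (ε : Fin n → ℕ) :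
    ∀ a ∈ minExponents t (∑ c ∈ Q, η c ^ 2 * uPow t (2 • c + ε)), ∃ c ∈ Q, a = 2 • c + ε := by
  classical
  haveI := ht.isRegularLocalRing
  intro a ha
  obtain ⟨hA, -, hmin⟩ := ht.minExponents_spec (∑ c ∈ Q, η c ^ 2 * uPow t (2 • c + ε))
  -- `a` lies above some `2c + ε`
  have hmem : ∑ c ∈ Q, η c ^ 2 * uPow t (2 • c + ε) ∈ Ideal.span (uPow t '' ↑(Q.image fun c => 2 • c + ε)) :=
    Ideal.sum_mem _ fun c hc => Ideal.mul_mem_left _ _ (uPow_mem_span_uPow t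
      (Finset.mem_coe.mpr (Finset.mem_image_of_mem _ hc)))
  obtain ⟨b, hb, hba⟩ := hmin _ hmem a ha
  -- take a minimal such `2c₀ + ε ≤ a`
  set D : Finset (Fin n → ℕ) := (Q.image fun c => 2 • c + ε).filter (fun e => e ≤ a) with hD
  have hbD : b ∈ D := Finset.mem_filter.mpr ⟨hb, hba⟩
  obtain ⟨e₀, -, he₀min⟩ := D.exists_le_minimal hbD
  obtain ⟨he₀Q, he₀a⟩ := Finset.mem_filter.mp he₀min.prop
  obtain ⟨c₀, hc₀, rfl⟩ := Finset.mem_image.mp he₀Q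
  -- `2c₀ + ε` is a minimal exponent (isolated with a unit coefficient)
  have hiso : 2 • c₀ + ε ∈ minExponents t (∑ c ∈ Q, η c ^ 2 * uPow t (2 • c + ε)) := by
    refine mem_minExponents_of_isolated t ht.mem_span_image_of_mul_mem ht.mem_maximalIdeal
      (s := η c₀ ^ 2) (ρ := ∑ c ∈ Q.erase c₀, η c ^ 2 * uPow t (2 • c + ε))
      (B := ↑((Q.erase c₀).image fun c => 2 • c + ε)) (by rw [← Finset.add_sum_erase Q _ hc₀])
      (Ideal.sum_mem _ fun c hc => Ideal.mul_mem_left _ _ (uPow_mem_span_uPow t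
        (Finset.mem_coe.mpr (Finset.mem_image_of_mem _ hc)))) (fun b' hb' hle => ?_) ?_
    · obtain ⟨c', hc', rfl⟩ := Finset.mem_image.mp (Finset.mem_coe.mp hb')
      obtain ⟨hne, hc'Q⟩ := Finset.mem_erase.mp hc'
      have hD' : 2 • c' + ε ∈ D := Finset.mem_filter.mpr ⟨Finset.mem_image_of_mem _ hc'Q, hle.trans he₀a⟩
      have := he₀min.eq_of_le hD' hle
      exact hne (two_nsmul_add_injective ε this)
    · intro hmem'
      haveI := isDomain_of_isRegularLocalRing S
      have hprime : (Ideal.span (Set.range t)).IsPrime := ht.isPrime_span_range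
      exact hη c₀ hc₀ ((hprime.mem_or_mem (by simpa [sq] using hmem')).elim id id)
  -- the antichain forces `a = 2c₀ + ε`
  have := hA.eq ha hiso
  exact ⟨c₀, hc₀, (hA.eq hiso ha he₀a).symm⟩

/-- **A minimal element of `{2c + ε : c ∈ Q}` is a minimal exponent of `Σ_{c ∈ Q} η_c² t^(2c + ε)`** (unit coefficients).
[cite: CossartPiltant2019, Prop. 2.1] -/
theorem two_nsmul_add_mem_minExponents_sum_sq [IsLocalRing S] {n : ℕ} {t : Fin n → S} (ht : IsRsopPart t)
    (Q : Finset (Fin n → ℕ)) {η : (Fin n → ℕ) → S} (hη : ∀ c ∈ Q, η c ∉ Ideal.span (Set.range t)) (ε : Fin n → ℕ)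
    {c₀ : Fin n → ℕ} (hc₀ : c₀ ∈ Q) (hmin : ∀ c ∈ Q, c ≤ c₀ → c = c₀) :
    2 • c₀ + ε ∈ minExponents t (∑ c ∈ Q, η c ^ 2 * uPow t (2 • c + ε)) := by
  classical
  haveI := ht.isRegularLocalRing
  refine mem_minExponents_of_isolated t ht.mem_span_image_of_mul_mem ht.mem_maximalIdeal
    (s := η c₀ ^ 2) (ρ := ∑ c ∈ Q.erase c₀, η c ^ 2 * uPow t (2 • c + ε))
    (B := ↑((Q.erase c₀).image fun c => 2 • c + ε)) (by rw [← Finset.add_sum_erase Q _ hc₀])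
    (Ideal.sum_mem _ fun c hc => Ideal.mul_mem_left _ _ (uPow_mem_span_uPow t
      (Finset.mem_coe.mpr (Finset.mem_image_of_mem _ hc)))) (fun b' hb' hle => ?_) ?_
  · obtain ⟨c', hc', rfl⟩ := Finset.mem_image.mp (Finset.mem_coe.mp hb')
    obtain ⟨hne, hc'Q⟩ := Finset.mem_erase.mp hc'
    have hle' : c' ≤ c₀ := by
      intro l
      have h2 : (2 • c' + ε) l ≤ (2 • c₀ + ε) l := hle l
      simp only [Pi.add_apply, Pi.smul_apply, smul_eq_mul] at h2
      show c' l ≤ c₀ l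
      omega
    exact hne (hmin c' hc'Q hle')
  · intro hmem'
    haveI := isDomain_of_isRegularLocalRing S
    have hprime : (Ideal.span (Set.range t)).IsPrime := ht.isPrime_span_range
    exact hη c₀ hc₀ ((hprime.mem_or_mem (by simpa [sq] using hmem')).elim id id)

end Summit.ResolutionOfSingularities.ResolutionOfSingularities.Theorems.SwitchingDichotomy.BetaNewton

end
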